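import Mathlib
import Literature.Computability.AlgebraicComplexity.StandardFamilies

/-!
# Crux `GrenetZeon.TwoDimCoefficients` (stmt-ValiantsHypothesis-8062), line `dim2_cases` — definitions

The registered skeleton `Cruxes/TwoDimCoefficients/Lines/dim2_cases.lean` (val-width-lines-2,
2026-08-27) factors the crux `TwoDimCoefficients` ("two-dimensional coefficients buy only a
constant": an `(m, ≤ 2)`-representation of `per_n` forces `n² ≤ C·m`) through a SHAPE
CLASSIFICATION — a commutative `ℂ`-algebra of dimension `≤ 2` is `0`, `ℂ`, `ℂ × ℂ` or `ℂ[ε]/ε²`, so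
the representation is SPLIT (`per_n = α det A + β det B`) or DUAL
(`per_n = α det A + β·tr(adj A · B)`, Jacobi) — and a UNIT DICHOTOMY for `det A` on the
permanental hypersurface.  This file holds the VOCABULARY of that line verbatim (so that the stub
theorem files `GrenetZeonTwoDimCoefficientsStub*.lean` of the three seats on the item are
definition-free and compose): the affine matrices `AffMat`, `IsAffine`, the hypothesis
`HasDim2Repr` of the crux at `(n, m)`, the two shapes `SplitRepr`, `DualRepr`, the isolated
sub-case `DualUnipotentRepr`, and the two intermediate statements `UnitDichotomy`,
`DualUnipotentBound` that the registered stubs take as hypotheses.  Nothing is proved here.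

HONEST FRAMING: the crux is a two-parameter constant-factor statement far below the
quasi-polynomial regime; `VP ≠ VNP` is not moved by anything in this development.

References: T. Mignon, N. Ressayre, Int. Math. Res. Not. 2004:79, Thm. 1.1 (the Hessian point);
J. M. Landsberg, *Geometry and Complexity Theory* (2017), §6.4 (determinantal complexity).
-/

-- single-conjunct layout `Summits/ValiantsHypothesis/ValiantsHypothesis`: the duplicated namespace
-- component is mandated by the tree.
set_option linter.dupNamespace false

noncomputable section

namespace Summit.ValiantsHypothesis.ValiantsHypothesis.Cruxes.TwoDimCoefficients.DimTwoCases

open Literature.Computability.AlgebraicComplexity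

/-- Affine `m × m` matrices over `ℂ[x_{ij} : i, j < n]` (the entries are polynomials; affineness is
the separate predicate `IsAffine`). [folklore] -/
abbrev AffMat (n m : ℕ) : Type := Matrix (Fin m) (Fin m) (MvPolynomial (Fin n × Fin n) ℂ)

/-- Entrywise affine-linear: every entry has total degree `≤ 1`. [folklore] -/
def IsAffine {n m : ℕ} (A : AffMat n m) : Prop := ∀ i j, (A i j).totalDegree ≤ 1

/-- The hypothesis of the crux `TwoDimCoefficients` at `(n, m)`, verbatim: an
`(m, ≤ 2)`-representation of `per_n` — a finite commutative `ℂ`-algebra `R` of dimension `≤ 2`, an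
affine `m × m` matrix over `R[x]` and a linear functional `l : R → ℂ` carrying the coefficients of
`det A` to those of `per_n`. [folklore] -/
def HasDim2Repr (n m : ℕ) : Prop :=
  ∃ (R : Type) (_ : CommRing R) (_ : Algebra ℂ R) (_ : Module.Finite ℂ R), Module.finrank ℂ R ≤ 2 ∧
    ∃ (l : R →ₗ[ℂ] ℂ) (A : Matrix (Fin m) (Fin m) (MvPolynomial (Fin n × Fin n) R)),
      (∀ i j, (A i j).totalDegree ≤ 1) ∧
      ∀ d : (Fin n × Fin n) →₀ ℕ, l (MvPolynomial.coeff d A.det) = MvPolynomial.coeff d (perPoly (Fin n) ℂ)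

/-- SPLIT shape (`R = ℂ × ℂ`, and the degenerate `R = ℂ` with `β = 0`):
`per_n = α·det A + β·det B`. [folklore] -/
def SplitRepr (n m : ℕ) : Prop :=
  ∃ (α β : ℂ) (A B : AffMat n m), IsAffine A ∧ IsAffine B ∧
    perPoly (Fin n) ℂ = MvPolynomial.C α * A.det + MvPolynomial.C β * B.det

/-- DUAL shape (`R = ℂ[ε]/ε²`): `per_n = α·det A + β·tr(adj A · B)` (Jacobi's formula for the
`ε`-coefficient of `det (A + εB)`). [folklore] -/
def DualRepr (n m : ℕ) : Prop :=
  ∃ (α β : ℂ) (A B : AffMat n m), IsAffine A ∧ IsAffine B ∧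
    perPoly (Fin n) ℂ = MvPolynomial.C α * A.det + MvPolynomial.C β * (A.adjugate * B).trace

/-- The isolated sub-case of the DUAL shape: `det A` a non-zero constant (unipotent / nilpotent
affine pencil). [folklore] -/
def DualUnipotentRepr (n m : ℕ) : Prop :=
  ∃ (α β c : ℂ) (A B : AffMat n m), IsAffine A ∧ IsAffine B ∧ c ≠ 0 ∧ A.det = MvPolynomial.C c ∧
    perPoly (Fin n) ℂ = MvPolynomial.C α * A.det + MvPolynomial.C β * (A.adjugate * B).trace

/-- UNIT DICHOTOMY (an intermediate statement of the line, the target of the registered stub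
`stub_unitDichotomy` and a hypothesis of `stub_splitCase` / `stub_dualCase`; a statement of this
development, no citation exists): if the affine determinant `det A` has no zero on the permanental
hypersurface (`n ≥ 3`), then either `det A` is constant or `n² ≤ 2m + 2`. -/
def UnitDichotomy : Prop :=
  ∀ n : ℕ, 3 ≤ n → ∀ (m : ℕ) (A : AffMat n m), IsAffine A →
    (∀ p : Fin n × Fin n → ℂ, MvPolynomial.eval p (perPoly (Fin n) ℂ) = 0 → MvPolynomial.eval p A.det ≠ 0) →
    (∃ c : ℂ, A.det = MvPolynomial.C c) ∨ n ^ 2 ≤ 2 * m + 2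

/-- The bound in the isolated sub-case (an intermediate statement of the line, the target of the
registered stub `stub_dualUnipotent` and a hypothesis of `stub_dualCase`; a statement of this
development, no citation exists): `DualUnipotentRepr n m → n² ≤ C·m` for large `n`. -/
def DualUnipotentBound : Prop :=
  ∃ C n₀ : ℕ, ∀ n ≥ n₀, ∀ m : ℕ, DualUnipotentRepr n m → n ^ 2 ≤ C * m

end Summit.ValiantsHypothesis.ValiantsHypothesis.Cruxes.TwoDimCoefficients.DimTwoCases

end
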